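import Literature.AlgebraicGeometry.Resolution.TameDescent
import Literature.AlgebraicGeometry.Resolution.TameRootLayers
import Literature.AlgebraicGeometry.Resolution.HenselianRationalityPerfectSplit
import Literature.AlgebraicGeometry.Resolution.ResidueTranscendentalExtensions
import Literature.AlgebraicGeometry.Resolution.Kuhlmann2019Lemma54Proofs
import Literature.AlgebraicGeometry.Resolution.KrasnerHenselian
import HarnessLib

/-!
# Henselian rationality over a perfect henselian ground field of rank one, split case (Temkin 2013, Thm. 3.2.3)

Topic: `Literature/AlgebraicGeometry/Resolution` (valued function fields). M. Temkin,
*Inseparable local uniformization*, J. Algebra 373 (2013) 65–119 = arXiv:0804.1554v3, Thm. 3.2.3: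

> Let `K` be a one-dimensional analytic `k`-field with trivial invariant `F_{K/k}` and assume
> that `k` is deeply ramified. Then `K` is isomorphic to a `k`-subfield of `\widehat{k^a}` or
> `K = \overline{l(T)}` for an element `T ∈ K` and a finite extension `l/k`.
> *Proof.* Step 1. The Theorem holds when `K` is `k`-split. By §2.4, `L^{mr}K = \overline{L^{mr}(x)}`
> for a finite moderately ramified extension … Our starting point is [temst], which implies that
> the Theorem holds when `K` is `k`-split and `k = k^{mr}` … by [Duc] … Step 2. The general case …

This file PROVES the split case in the henselian rendering of the tree — the statement (HR)
isolated by `RelativeCurveValuativeInputCharP.lean` as the one valuation-theoretic input of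
Temkin's Thm. 3.3.1 in characteristic `p` (there: `valuativeInput_charP_of_henselianRational :
(HR) ⇒ (J1)`; with `Temkin2013RelativeCurveSmoothFibre.of_inputs : (J1) → (J2) → ` the named
fact):

> **(HR)** for `C ≤ F ≤ Ω` (`(Ω, V)` algebraically closed of characteristic `p`, residue
> characteristic `p`) with `C` perfect, henselian, of rank one, `F|C` finitely and separably
> generated of transcendence degree `1`, `(F|C, V)` immediate and `C` algebraically closed in
> `F^h`: `F ≤ C(x)^h` for some `x ∈ F` transcendental over `C`.

Temkin's two steps become: pass to a tame `T ⊇ C` without proper tame extensions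
(`exists_tame_extension`, `TameRootLayers.lean` — the algebraic stand-in for `L^{mr}`); there
`T·F` is henselian rational (`henselianRational_of_perfect_of_forall_isAlgebraic_mem`,
`HenselianRationalityPerfectSplit.lean` = [temst] Thm. 6.3.1 in Kuhlmann's architecture);
descend to a finite tame root layer `L` and, if the generator is not a limit of elements of `L`,
pull it down to `C` (`le_henselization_of_rootLayer`, `TameDescent.lean` = Kuhlmann–Vlahu 2014,
Thm. 14.5 — Temkin's [Duc]) and move it into `F` (`kuhlmannVlahu_thm111_of_perfect`); if it is
such a limit, every element of `F^h` is a limit of elements of `C` (Kuhlmann–Vlahu Lemma 14.1's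
mechanism and `C`-splitness, Cor. 3.1.10) and any separating element of `F|C` generates `F^h`
(Kuhlmann 2019, Thm. 2.3) — the henselian shadow of Temkin's case "`K ⊆ \widehat{k^a}`"
(Thm. 3.2.4), which needs no separate treatment here.

* `forall_exists_valuation_sub_lt_of_mem_henselization_closure'` — if `x` is a limit of
  elements of `K` then so is every element of `K(x)^h` — PROVED;
* `henselianRational_of_perfect` — **(HR)** [cite: Temkin2013, Thm. 3.2.3] — PROVED.

No definitions, no named facts.

## Sources

* M. Temkin, J. Algebra 373 (2013) = arXiv:0804.1554v3, §3.1 Cor. 3.1.10, §3.2 Thm. 3.2.3 and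
  its proof (Steps 1–2), Thm. 3.2.4, pp. 22–25 of the held arXiv text. [Temkin2013]
* M. Temkin, *Stable modification of relative curves*, J. Algebraic Geom. 19 (2010) =
  arXiv:0707.3953, Thm. 6.3.1 ([temst]).
* F.-V. Kuhlmann, I. Vlahu, Math. Z. 276 (2014) = arXiv:1304.0200, Thm. 11.1, Lemma 14.1,
  Thm. 14.5. [KuhlmannVlahu2014]
* F.-V. Kuhlmann, Israel J. Math. 234 (2019) = arXiv:1701.05508, Thm. 2.3, Prop. 5.2. [Kuhlmann2019]
-/

noncomputable section

open Polynomial Finset IsLocalRing IntermediateField Module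

namespace Literature.AlgebraicGeometry.Resolution

universe u

variable {Ω : Type u} [Field Ω] [IsAlgClosed Ω] (V : ValuationSubring Ω)

/-! ### Limits of elements of `K` (Kuhlmann–Vlahu 2014, Lemma 14.1, mechanism) -/

section Limits

/-- **If `x` is a limit of elements of `K`, so is every element of `K(x)^h`.** Let `K ≤ M ≤ Ω`
with `(M|K, V)` immediate and `K` of rank one, `x ∈ M`, and suppose that for every `e ∈ K^×`
there is `b ∈ K` with `|x − b| < |e|`. Then the same holds for every `z ∈ K(x)^h` ("`x ∈ L^c`
would imply that `L(x) ⊂ L^c` … so we would get that `F.L ⊂ F^h.L = L(x)^h ⊂ L^c`", proof of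
Lemma 14.1): rational functions of `x` by the ultrametric estimates, elements of the
henselization by density (Kuhlmann 2010, Lemma 2.4). [cite: KuhlmannVlahu2014, Lemma 14.1 (proof)] -/
theorem forall_exists_valuation_sub_lt_of_mem_henselization_closure' {K M : Subfield Ω} (hKM : K ≤ M)
    (himm : IsImmediateOver V K M) (hr1 : IsRankOneValued V K) {x : Ω} (hxM : x ∈ M)
    (hx : ∀ e ∈ K, e ≠ 0 → ∃ b ∈ K, V.valuation (x - b) < V.valuation e)
    {z : Ω} (hz : z ∈ henselization V (Subfield.closure ((K : Set Ω) ∪ {x}))) :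
    ∀ e ∈ K, e ≠ 0 → ∃ b ∈ K, V.valuation (z - b) < V.valuation e := by
  classical
  set Kx : Subfield Ω := Subfield.closure ((K : Set Ω) ∪ {x}) with hKxdef
  have hKKx : K ≤ Kx := fun c hc => Subfield.subset_closure (Or.inl hc)
  have hKxM : Kx ≤ M := Subfield.closure_le.mpr (Set.union_subset hKM (Set.singleton_subset_iff.mpr hxM))
  have himmx : IsImmediateOver V K Kx := himm.mono_right hKxM
  have hr1x : IsRankOneValued V Kx := hr1.of_isImmediateOver hKKx himmx
  have hval : ∀ w ∈ Kx, w ≠ 0 → ∃ b ∈ K, V.valuation w = V.valuation b := himmx.1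
  -- the statement for `K(x)` by induction over the field operations
  have key : ∀ w ∈ Kx, ∀ e ∈ K, e ≠ 0 → ∃ b ∈ K, V.valuation (w - b) < V.valuation e := by
    intro w hw
    refine Subfield.closure_induction (p := fun w _ => ∀ e ∈ K, e ≠ 0 → ∃ b ∈ K,
      V.valuation (w - b) < V.valuation e) ?_ ?_ ?_ ?_ ?_ ?_ hw
    · rintro y (hyK | hyx) e heK he0
      · exact ⟨y, hyK, by rw [sub_self, map_zero]; exact (Valuation.pos_iff _).mpr he0⟩
      · rw [Set.mem_singleton_iff.mp hyx]; exact hx e heK he0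
    · intro e heK he0
      exact ⟨1, K.one_mem, by rw [sub_self, map_zero]; exact (Valuation.pos_iff _).mpr he0⟩
    · intro y₁ y₂ _ _ ih₁ ih₂ e heK he0
      obtain ⟨b₁, hb₁K, hb₁⟩ := ih₁ e heK he0
      obtain ⟨b₂, hb₂K, hb₂⟩ := ih₂ e heK he0
      refine ⟨b₁ + b₂, add_mem hb₁K hb₂K, ?_⟩
      have hid : y₁ + y₂ - (b₁ + b₂) = (y₁ - b₁) + (y₂ - b₂) := by ring
      rw [hid]; exact Valuation.map_add_lt _ hb₁ hb₂
    · intro y _ ih e heK he0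
      obtain ⟨b, hbK, hb⟩ := ih e heK he0
      refine ⟨-b, neg_mem hbK, ?_⟩
      have hid : -y - -b = -(y - b) := by ring
      rw [hid, Valuation.map_neg]; exact hb
    · intro y hy ih e heK he0
      by_cases hy0 : y = 0
      · exact ⟨0, K.zero_mem, by rw [hy0, inv_zero, sub_self, map_zero]; exact (Valuation.pos_iff _).mpr he0⟩
      obtain ⟨w, hwK, hw⟩ := hval y hy hy0
      have hw0 : w ≠ 0 := by rintro rfl; rw [map_zero, map_eq_zero] at hw; exact hy0 hw
      have hvw0 : V.valuation w ≠ 0 := (Valuation.ne_zero_iff _).mpr hw0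
      -- a threshold `e' ∈ K^×` with `|e'| ≤ |w|` and `|e'| ≤ |e| |w|²`
      obtain ⟨e', he'K, he'0, he'w, he'e⟩ : ∃ e' ∈ K, e' ≠ 0 ∧ V.valuation e' ≤ V.valuation w ∧
          V.valuation e' ≤ V.valuation e * V.valuation w ^ 2 := by
        rcases le_total (V.valuation w) (V.valuation e * V.valuation w ^ 2) with h | h
        · exact ⟨w, hwK, hw0, le_rfl, h⟩
        · exact ⟨e * w ^ 2, mul_mem heK (pow_mem hwK 2), mul_ne_zero he0 (pow_ne_zero 2 hw0),
            by rw [map_mul, map_pow]; exact h, by rw [map_mul, map_pow]⟩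
      obtain ⟨b, hbK, hb⟩ := ih e' he'K he'0
      have hvb : V.valuation b = V.valuation y := by
        have h1 : V.valuation (y - b) < V.valuation y := by rw [hw]; exact lt_of_lt_of_le hb he'w
        have hid : b = y - (y - b) := by ring
        rw [hid, Valuation.map_sub_eq_of_lt_left _ h1]
      have hb0 : b ≠ 0 := by rintro rfl; rw [map_zero] at hvb; exact hy0 ((map_eq_zero _).mp hvb.symm)
      refine ⟨b⁻¹, inv_mem hbK, ?_⟩
      have hid : y⁻¹ - b⁻¹ = (b - y) / (y * b) := by field_simp
      rw [hid, map_div₀, map_mul, ← Valuation.map_neg, neg_sub, hvb, hw, ← pow_two]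
      calc V.valuation (y - b) / V.valuation w ^ 2 < V.valuation e' / V.valuation w ^ 2 :=
            div_lt_div_of_pos_right hb (pow_pos (zero_lt_iff.mpr hvw0) 2)
        _ ≤ V.valuation e := by
            rw [div_le_iff₀ (pow_pos (zero_lt_iff.mpr hvw0) 2)]; exact he'e
    · intro y₁ y₂ hy₁ _ ih₁ ih₂ e heK he0
      by_cases hy₁0 : y₁ = 0
      · exact ⟨0, K.zero_mem, by rw [hy₁0, zero_mul, sub_self, map_zero]; exact (Valuation.pos_iff _).mpr he0⟩
      obtain ⟨w₁, hw₁K, hw₁⟩ := hval y₁ hy₁ hy₁0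
      have hw₁0 : w₁ ≠ 0 := by rintro rfl; rw [map_zero, map_eq_zero] at hw₁; exact hy₁0 hw₁
      have hvw₁0 : V.valuation w₁ ≠ 0 := (Valuation.ne_zero_iff _).mpr hw₁0
      obtain ⟨b₂, hb₂K, hb₂⟩ := ih₂ (e / w₁) (div_mem heK hw₁K) (div_ne_zero he0 hw₁0)
      by_cases hb₂0 : b₂ = 0
      · refine ⟨0, K.zero_mem, ?_⟩
        rw [hb₂0, sub_zero] at hb₂
        rw [sub_zero, map_mul, hw₁]
        calc V.valuation w₁ * V.valuation y₂ < V.valuation w₁ * V.valuation (e / w₁) :=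
              mul_lt_mul_of_pos_left hb₂ (zero_lt_iff.mpr hvw₁0)
          _ = V.valuation e := by rw [map_div₀, mul_div_cancel₀ _ hvw₁0]
      have hvb₂0 : V.valuation b₂ ≠ 0 := (Valuation.ne_zero_iff _).mpr hb₂0
      obtain ⟨b₁, hb₁K, hb₁⟩ := ih₁ (e / b₂) (div_mem heK hb₂K) (div_ne_zero he0 hb₂0)
      refine ⟨b₁ * b₂, mul_mem hb₁K hb₂K, ?_⟩
      have hid : y₁ * y₂ - b₁ * b₂ = y₁ * (y₂ - b₂) + b₂ * (y₁ - b₁) := by ring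
      rw [hid]
      refine Valuation.map_add_lt _ ?_ ?_
      · rw [map_mul, hw₁]
        calc V.valuation w₁ * V.valuation (y₂ - b₂) < V.valuation w₁ * V.valuation (e / w₁) :=
              mul_lt_mul_of_pos_left hb₂ (zero_lt_iff.mpr hvw₁0)
          _ = V.valuation e := by rw [map_div₀, mul_div_cancel₀ _ hvw₁0]
      · rw [map_mul]
        calc V.valuation b₂ * V.valuation (y₁ - b₁) < V.valuation b₂ * V.valuation (e / b₂) :=
              mul_lt_mul_of_pos_left hb₁ (zero_lt_iff.mpr hvb₂0)
          _ = V.valuation e := by rw [map_div₀, mul_div_cancel₀ _ hvb₂0]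
  -- density of `K(x)` in its henselization
  intro e heK he0
  obtain ⟨y, hyKx, hzy⟩ := exists_mem_valuation_sub_lt_of_isRankOneValued hr1x hz (hKKx heK) he0
  obtain ⟨b, hbK, hyb⟩ := key y hyKx e heK he0
  refine ⟨b, hbK, ?_⟩
  have hid : z - b = (z - y) + (y - b) := by ring
  rw [hid]; exact Valuation.map_add_lt _ hzy hyb

end Limits

/-! ### (HR): henselian rationality over a perfect henselian ground field of rank one -/

section Main

/-- **Temkin 2013, Thm. 3.2.3 (split case), henselian form = (HR) of
`RelativeCurveValuativeInputCharP.lean`.** Let `Ω` be algebraically closed of characteristic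
`p` with valuation ring `V` (residue characteristic `p`), `C ≤ F ≤ Ω` with `C` perfect,
henselian and of rank one, `F|C` finitely and separably generated of transcendence degree one,
`(F|C, V)` immediate, and such that every element of `F^h` algebraic over `C` lies in `C`. Then
`(F|C, V)` is HENSELIAN RATIONAL: `F ≤ C(x)^h` for some `x ∈ F` transcendental over `C`.
See the module docstring for the proof (Temkin's Step 1 — tame closure, [temst], [Duc] — in the
tree's algebraic rendering). [cite: Temkin2013, Thm. 3.2.3] -/
theorem henselianRational_of_perfect (p : ℕ) [hp : Fact p.Prime] [CharP Ω p]
    [CharP (ResidueField V) p] (C F : Subfield Ω)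
    (hC : IsHenselianField C (V.comap (algebraMap C Ω))) (hperfC : ∀ y ∈ C, ∃ b ∈ C, b ^ p = y)
    (hr : IsRankOne V C) (hCF : C ≤ F) (hfg : FGOver C F) (hsg : SeparablyGeneratedOver C F)
    (h1 : ∃ t ∈ F, Transcendental C t ∧
      ∀ z ∈ F, IsAlgebraic (IntermediateField.adjoin C ({t} : Set Ω)) z)
    (himmF : IsImmediateOver V C F)
    (hrelF : ∀ a ∈ henselization V F, IsAlgebraic C a → a ∈ C) :
    ∃ x ∈ F, Transcendental C x ∧ F ≤ henselization V (Subfield.closure ((C : Set Ω) ∪ {x})) := by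
  classical
  have hhens := Kuhlmann2010HenselizationIsHenselian_holds.{u}
  haveI : PerfectField C := perfectField_of_forall_exists_pow_eq p hperfC
  obtain ⟨s₀, hs₀⟩ := hfg
  obtain ⟨t, htF, htC, halgt⟩ := h1
  have hr1C : IsRankOneValued V C := isRankOneValued_of_overrings V C hr.1 hr.2
  ---------------------------------------------------------------- `E = F^h`
  set E : Subfield Ω := henselization V F with hEdef
  have hFE : F ≤ E := le_henselization V F
  have hCE : C ≤ E := hCF.trans hFE
  have hE : IsHenselianField E (V.comap (algebraMap E Ω)) := hhens Ω V F
  have hrel : ∀ a ∈ E, IsAlgebraic C a → a ∈ C := hrelF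
  have himm : IsImmediateOver V C E := himmF.trans (Kuhlmann2010HenselizationImmediate_holds Ω V F)
  ---------------------------------------------------------------- Step 1: the tame extension `T`
  obtain ⟨T, hCT, hTalg, hT, hperfT, hdivT, hresT, hr1T, hTfin, hTlayers⟩ :=
    exists_tame_extension V p hC hperfC hr1C
  haveI : PerfectField T := perfectField_of_forall_exists_pow_eq p hperfT
  have hlayer_imm : ∀ P : Polynomial C,
      IsImmediateOver V (IntermediateField.adjoin C (P.rootSet Ω)).toSubfield
        (IntermediateField.adjoin E (P.rootSet Ω)).toSubfield := fun P =>
    isImmediateOver_rootLayer V hCE P p hperfC hrel hE himm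
  -- `E·T` and its elements
  set ET : Subfield Ω := Subfield.closure ((E : Set Ω) ∪ T) with hETdef
  have hEET : E ≤ ET := fun a ha => Subfield.subset_closure (Or.inl ha)
  have hTET : T ≤ ET := fun a ha => Subfield.subset_closure (Or.inr ha)
  have hmemET : ∀ a ∈ ET, ∃ P : Polynomial C, P ≠ 0 ∧
      ramificationGroupIn V (IntermediateField.adjoin C (P.rootSet Ω)) = ⊥ ∧
      a ∈ (IntermediateField.adjoin E (P.rootSet Ω)).toSubfield := by
    let ι := {P : Polynomial C // P ≠ 0 ∧ ramificationGroupIn V (IntermediateField.adjoin C (P.rootSet Ω)) = ⊥}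
    let S : ι → Subfield Ω := fun P => Subfield.closure ((E : Set Ω) ∪ (IntermediateField.adjoin C (P.1.rootSet Ω)))
    haveI : Nonempty ι := ⟨⟨1, one_ne_zero, ramificationGroupIn_adjoin_rootSet_one_eq_bot V⟩⟩
    have hdir : Directed (· ≤ ·) S := by
      intro P Q
      refine ⟨⟨P.1 * Q.1, mul_ne_zero P.2.1 Q.2.1,
        ramificationGroupIn_adjoin_rootSet_mul_eq_bot V P.2.1 Q.2.1 P.2.2 Q.2.2⟩, ?_, ?_⟩
      · exact Subfield.closure_mono (Set.union_subset_union_right _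
          fun w hw => adjoin_rootSet_le_mul_left P.2.1 Q.2.1 hw)
      · exact Subfield.closure_mono (Set.union_subset_union_right _
          fun w hw => adjoin_rootSet_le_mul_right P.2.1 Q.2.1 hw)
    have hsup : ET ≤ ⨆ i, S i := by
      refine Subfield.closure_le.mpr (Set.union_subset ?_ ?_)
      · intro a ha
        exact (le_iSup S (Classical.arbitrary ι)) (Subfield.subset_closure (Or.inl ha))
      · intro a ha
        obtain ⟨P, hP0, hP, haP⟩ := hTfin {a} (by simpa using ha)
        refine (le_iSup S ⟨P, hP0, hP⟩) (Subfield.subset_closure (Or.inr ?_))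
        exact haP (by simp)
    intro a ha
    obtain ⟨P, haS⟩ := (Subfield.mem_iSup_of_directed hdir).mp (hsup ha)
    refine ⟨P.1, P.2.1, P.2.2, ?_⟩
    have hle : S P ≤ (IntermediateField.adjoin E (P.1.rootSet Ω)).toSubfield :=
      Subfield.closure_le.mpr (Set.union_subset (le_toSubfield_adjoin_rootSet_top P.1)
        (toSubfield_adjoin_rootSet_le hCE P.1))
    exact hle haS
  have himmET : IsImmediateOver V T ET := by
    refine ⟨fun a ha ha0 => ?_, fun r hr' => ?_⟩
    · obtain ⟨P, hP0, hP, haM⟩ := hmemET a ha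
      obtain ⟨b, hbL, hb⟩ := (hlayer_imm P).1 a haM ha0
      exact ⟨b, hTlayers P hP0 hP hbL, hb⟩
    · obtain ⟨a, haET, rfl⟩ := (mem_resField_iff V ET r).mp hr'
      obtain ⟨P, hP0, hP, haM⟩ := hmemET a haET
      have h := (hlayer_imm P).2 (residue_mem_resField V a haM)
      exact resField_mono V (fun w hw => hTlayers P hP0 hP hw) h
  have hETalg : ∀ a ∈ ET, IsAlgebraic E a := fun a ha =>
    isAlgebraic_of_mem_closure (fun x hx => isAlgebraic_of_subfield_le hCE (hTalg x hx)) ha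
  have hEThens : IsHenselianField ET (V.comap (algebraMap ET Ω)) :=
    IsHenselianField.of_subfield_algebraic V hEET hETalg hE
  ---------------------------------------------------------------- Step 2: `T·F` is henselian rational ([temst])
  set F₂ : Subfield Ω := Subfield.closure ((T : Set Ω) ∪ ↑s₀) with hF₂def
  have hTF₂ : T ≤ F₂ := fun a ha => Subfield.subset_closure (Or.inl ha)
  have hFF₂ : F ≤ F₂ := by
    rw [← hs₀]; exact Subfield.closure_mono (Set.union_subset_union_left _ hCT)
  have hF₂ET : F₂ ≤ ET := Subfield.closure_le.mpr (Set.union_subset hTET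
    (fun z hz => hEET (hFE (hs₀ ▸ Subfield.subset_closure (Or.inr hz)))))
  have hfg₂ : FGOver T F₂ := ⟨s₀, rfl⟩
  have hsg₂ : SeparablyGeneratedOver T F₂ := separablyGeneratedOver_of_perfectField hfg₂
  have hTalgC : ∀ a ∈ T, IsAlgebraic C a := hTalg
  have htT : Transcendental T t := fun h => htC (isAlgebraic_trans_subfield hCT hTalgC h)
  have halgt' : ∀ z ∈ F, IsAlgebraic (Subfield.closure ((C : Set Ω) ∪ {t})) z := fun z hz =>
    (isAlgebraic_closure_iff C {t} z).mpr (halgt z hz)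
  have h1₂ : ∃ t ∈ F₂, Transcendental T t ∧
      ∀ z ∈ F₂, IsAlgebraic (IntermediateField.adjoin T ({t} : Set Ω)) z := by
    refine ⟨t, hFF₂ htF, htT, fun z hz => ?_⟩
    rw [← isAlgebraic_closure_iff]
    have hz' : z ∈ Subfield.closure (((Subfield.closure ((T : Set Ω) ∪ {t}) : Subfield Ω) : Set Ω) ∪ F) := by
      refine (Subfield.closure_le.mpr ?_ : F₂ ≤ _) hz
      refine Set.union_subset (fun a ha => Subfield.subset_closure (Or.inl (Subfield.subset_closure (Or.inl ha)))) ?_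
      exact fun a ha => Subfield.subset_closure (Or.inr (hs₀ ▸ Subfield.subset_closure (Or.inr ha)))
    refine isAlgebraic_of_mem_closure (fun x hx => ?_) hz'
    exact isAlgebraic_of_subfield_le (Subfield.closure_mono (Set.union_subset_union_left _ hCT)) (halgt' x hx)
  have himm₂ : IsImmediateOver V T F₂ := himmET.mono_right hF₂ET
  have hhensF₂ : henselization V F₂ ≤ ET := henselization_le_of_isHenselianField V F₂ hF₂ET hEThens
  have hrel₂ : ∀ a ∈ henselization V F₂, IsAlgebraic T a → a ∈ T := by
    intro a ha halg
    obtain ⟨P, hP0, hP, haM⟩ := hmemET a (hhensF₂ ha)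
    have haC : IsAlgebraic C a := isAlgebraic_trans_subfield hCT hTalgC halg
    exact hTlayers P hP0 hP (mem_adjoin_rootSet_of_isAlgebraic hCE P hrel haM haC)
  obtain ⟨x, hxF₂, hxT, hF₂x⟩ := henselianRational_of_perfect_of_forall_isAlgebraic_mem V p T F₂ hT hperfT
    (isRankOne_of_isRankOneValued V hr1T) hdivT hresT hTF₂ hfg₂ hsg₂ h1₂ himm₂ hrel₂
  ---------------------------------------------------------------- Step 3: descend to a tame root layer
  obtain ⟨u₁, hu₁T, hu₁⟩ := exists_finset_forall_mem_closure_levels hCT (↑s₀ : Set Ω) {x}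
    (fun z hz => by rw [Finset.mem_singleton.mp hz]; exact hxF₂)
  obtain ⟨P₁, hP₁0, hP₁, hu₁P₁⟩ := hTfin u₁ hu₁T
  have hs₀hens : ∀ z ∈ s₀, z ∈ henselization V (Subfield.closure ((T : Set Ω) ∪ {x})) := fun z hz =>
    hF₂x (Subfield.subset_closure (Or.inr hz))
  obtain ⟨u₂, hu₂T, hu₂⟩ := exists_finset_forall_mem_henselization_closure_levels V hCT {x} s₀ hs₀hens
  obtain ⟨P₂, hP₂0, hP₂, hu₂P₂⟩ := hTfin u₂ hu₂T
  set P : Polynomial C := P₁ * P₂ with hPdef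
  have hram : ramificationGroupIn V (IntermediateField.adjoin C (P.rootSet Ω)) = ⊥ :=
    ramificationGroupIn_adjoin_rootSet_mul_eq_bot V hP₁0 hP₂0 hP₁ hP₂
  have hL₁L : IntermediateField.adjoin C (P₁.rootSet Ω) ≤ IntermediateField.adjoin C (P.rootSet Ω) :=
    adjoin_rootSet_le_mul_left hP₁0 hP₂0
  have hL₂L : IntermediateField.adjoin C (P₂.rootSet Ω) ≤ IntermediateField.adjoin C (P.rootSet Ω) :=
    adjoin_rootSet_le_mul_right hP₁0 hP₂0
  have hLM : (IntermediateField.adjoin C (P.rootSet Ω)).toSubfield ≤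
      (IntermediateField.adjoin E (P.rootSet Ω)).toSubfield := toSubfield_adjoin_rootSet_le hCE P
  have hCL : C ≤ (IntermediateField.adjoin C (P.rootSet Ω)).toSubfield := le_toSubfield_adjoin_rootSet P
  have hEM : E ≤ (IntermediateField.adjoin E (P.rootSet Ω)).toSubfield := le_toSubfield_adjoin_rootSet_top P
  have hxM : x ∈ (IntermediateField.adjoin E (P.rootSet Ω)).toSubfield := by
    have hx₁ := hu₁ x (Finset.mem_singleton_self x)
    refine (Subfield.closure_le.mpr ?_) hx₁
    refine Set.union_subset (Set.union_subset (hCL.trans hLM) fun w hw => hLM (hL₁L (hu₁P₁ hw))) ?_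
    exact fun z hz => hEM (hFE (hs₀ ▸ Subfield.subset_closure (Or.inr hz)))
  have hxt : Transcendental C x := fun h => hxT (isAlgebraic_of_subfield_le hCT h)
  -- `M ⊆ L(x)^h`
  set H : Subfield Ω := henselization V (Subfield.closure
    ((((IntermediateField.adjoin C (P.rootSet Ω)).toSubfield : Subfield Ω) : Set Ω) ∪ {x})) with hHdef
  have hH : IsHenselianField H (V.comap (algebraMap H Ω)) := hhens Ω V _
  have hLxH : Subfield.closure ((((IntermediateField.adjoin C (P.rootSet Ω)).toSubfield : Subfield Ω) : Set Ω) ∪ {x}) ≤ H :=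
    le_henselization V _
  have hLH : (IntermediateField.adjoin C (P.rootSet Ω)).toSubfield ≤ H := fun w hw => hLxH (Subfield.subset_closure (Or.inl hw))
  have hs₀H : ∀ z ∈ s₀, z ∈ H := by
    intro z hz
    refine henselization_mono V hhens ?_ (hu₂ z hz)
    refine Subfield.closure_le.mpr (Set.union_subset (Set.union_subset ?_ ?_) ?_)
    · exact fun c hc => Subfield.subset_closure (Or.inl (hCL hc))
    · exact fun w hw => Subfield.subset_closure (Or.inl (hL₂L (hu₂P₂ hw)))
    · exact Set.singleton_subset_iff.mpr (Subfield.subset_closure (Or.inr rfl))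
  have hFH : F ≤ H := by
    rw [← hs₀]; exact Subfield.closure_le.mpr (Set.union_subset (hCL.trans hLH) fun z hz => hs₀H z hz)
  have hEH : E ≤ H := henselization_le_of_isHenselianField V F hFH hH
  have hMH : ((IntermediateField.adjoin E (P.rootSet Ω) : IntermediateField E Ω) : Set Ω) ⊆ H := by
    intro w hw
    have hw' : w ∈ Subfield.closure ((E : Set Ω) ∪ P.rootSet Ω) := (mem_adjoin_subfield_iff E _ w).mp hw
    refine (Subfield.closure_le.mpr (Set.union_subset hEH ?_)) hw'
    exact fun z hz => hLH (IntermediateField.subset_adjoin C _ hz)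
  ---------------------------------------------------------------- Step 4: pull down ([Duc]) or type 1
  have hfg' : FGOver C F := ⟨s₀, hs₀⟩
  by_cases hex : ∃ e ∈ (IntermediateField.adjoin C (P.rootSet Ω)).toSubfield, e ≠ 0 ∧
      ∀ b ∈ (IntermediateField.adjoin C (P.rootSet Ω)).toSubfield, V.valuation e ≤ V.valuation (x - b)
  · -- CASE A: the generator is not a limit of constants — pull it down through the tame layer
    obtain ⟨y, hyE, hyt, hEy⟩ := le_henselization_of_rootLayer V hCE P p hperfC hrel hC hE hr1C himm hram hxM hxt hex hMH
    exact kuhlmannVlahu_thm111_of_perfect V p C F y hC hperfC hr hCF hfg' hsg ⟨t, htF, htC, halgt⟩ himmF hrelF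
      hyE hyt (hFE.trans hEy)
  · -- CASE B: the generator is a limit of elements of `L`; then `E` lies in the completion of `C`
    push Not at hex
    have hr1L : IsRankOneValued V (IntermediateField.adjoin C (P.rootSet Ω)).toSubfield :=
      IsRankOneValued.of_algebraic V hCL hr1C fun _ hw => isAlgebraic_of_mem_toSubfield_adjoin_rootSet P hw
    have hHlim : ∀ z ∈ H, ∀ e ∈ (IntermediateField.adjoin C (P.rootSet Ω)).toSubfield, e ≠ 0 →
        ∃ b ∈ (IntermediateField.adjoin C (P.rootSet Ω)).toSubfield, V.valuation (z - b) < V.valuation e :=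
      fun z hz => forall_exists_valuation_sub_lt_of_mem_henselization_closure' V hLM (hlayer_imm P) hr1L hxM hex hz
    -- every element of `E` is a limit of elements of `C` (splitness, Cor. 3.1.10)
    have hElim : ∀ z ∈ E, ∀ e ∈ C, e ≠ 0 → ∃ c ∈ C, V.valuation (z - c) < V.valuation e := by
      intro z hzE e heC he0
      by_contra hall
      push Not at hall
      obtain ⟨b, hbL, hb⟩ := hHlim z (hEH hzE) e (hCL heC) he0
      have hsplit := valuation_le_sub_of_forall_isAlgebraic_mem_of_perfect V p hCE hC hperfC hr1C hE hrel hzE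
        (isAlgebraic_of_mem_toSubfield_adjoin_rootSet P hbL) (isAlgebraic_algebraMap (⟨e, heC⟩ : C)) hall
      exact absurd hsplit (not_le.mpr hb)
    -- a separating element of `F|C` generates the henselization (Kuhlmann 2019, Thm. 2.3)
    obtain ⟨y, hyF, hyt, hysep⟩ := exists_separating_of_separablyGeneratedOver hsg ⟨t, htF, htC, halgt⟩
    refine ⟨y, hyF, hyt, fun w hw => ?_⟩
    have hCyE : Subfield.closure ((C : Set Ω) ∪ {y}) ≤ E :=
      Subfield.closure_le.mpr (Set.union_subset hCE (Set.singleton_subset_iff.mpr (hFE hyF)))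
    have hN₀ : IsHenselianField (henselization V (Subfield.closure ((C : Set Ω) ∪ {y})))
        (V.comap (algebraMap (henselization V (Subfield.closure ((C : Set Ω) ∪ {y}))) Ω)) := hhens Ω V _
    have hN₀E : henselization V (Subfield.closure ((C : Set Ω) ∪ {y})) ≤ E :=
      henselization_le_of_isHenselianField V _ hCyE hE
    have hCN₀ : C ≤ henselization V (Subfield.closure ((C : Set Ω) ∪ {y})) := fun c hc =>
      le_henselization V _ (Subfield.subset_closure (Or.inl hc))
    have hwsep : IsSeparable (henselization V (Subfield.closure ((C : Set Ω) ∪ {y}))) w :=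
      isSeparable_of_subfield_le (le_henselization V _) (hysep w hw)
    refine mem_of_isHenselianField_of_forall_exists_valuation_sub_lt V hN₀ hwsep fun e heN₀ he0 => ?_
    obtain ⟨e', he'C, hee'⟩ := himm.1 e (hN₀E heN₀) he0
    have he'0 : e' ≠ 0 := by rintro rfl; rw [map_zero, map_eq_zero] at hee'; exact he0 hee'
    obtain ⟨c, hcC, hc⟩ := hElim w (hFE hw) e' he'C he'0
    exact ⟨c, hCN₀ hcC, by rw [hee']; exact hc⟩

end Main

end Literature.AlgebraicGeometry.Resolution

end
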